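import Summits.Ventures.HodgeRepro2.Incoherent
import Summits.Ventures.HodgeRepro2.PicardExists

/-!
# HodgeRepro2 — the reduced reflex field of the Picard datum depends only on the embedding above
the `(n,1)`-place (Liu, Remark C.2); half of "the reflex field is `τ'(E)`" (proved)

Blind re-derivation cell `pub-hodge-repro2`, seat p2 (file 6; imports `Incoherent.lean` and
`PicardExists.lean`).  Everything here is PROVED except the definition `IsPicardSignaturePos`.

[Liu21] = Y. Liu, Cambridge J. Math. 9 (2021) 1–147, Appendix C, Remark C.2 p. 108 (QUOTE):
"Suppose that there is an element `τ ∈ Φ_F` such that `V` has signature `(n − 1, 1)` at `τ` and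
`(n, 0)` at other places. Then the Hodge map `h_{V,Φ}` hence the Shimura variety
`Sh(G, h_{V,Φ})_K` depend only on `Φ ∩ π^{−1}τ`, that is, the unique element contained in `Φ`
above `τ`. […] In particular, the reflex field of `h_{V,τ'}` is `τ'(E)`."

## Contents
* `IsPicardSignaturePos`: the positive-definite normalisation `(n,1)` at `τ₁`, `(n+1,0)` at every
  other infinite place (Liu's hypothesis; [DR15]'s "`(n+1,0)` or `(0,n+1)`" allows both signs);
  `IsPicardSignaturePos.isPicardSignature`.
* `reducedSig_eq_single`: under it the reduced signature `Σ q_τ τ⁻` ([Liu21] Def. C.1) is `1` at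
  the embedding `Φ(mk τ₁)` chosen above the `(n,1)`-place and `0` at every other embedding.
* `reducedSig_eq_of_emb_eq`, `reducedReflexField_eq_of_emb_eq`: the reduced signature and the
  reduced reflex field depend only on `Φ(mk τ₁)` (Remark C.2, first sentence).
* `reducedStabilizer_eq`: the stabiliser is `{σ ∈ Aut ℂ | σ ∘ τ₁' = τ₁'}`, `τ₁' = Φ(mk τ₁)`.
* `fieldRange_le_reducedReflexField`: `τ₁'(K) ⊆ E'_{V,Φ}` — the easy half of "`= τ'(E)`" (the
  other half, that `Aut(ℂ/τ₁'(K))` fixes nothing outside `τ₁'(K)`, is Galois theory of `ℂ` and is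
  left as the `Prop` `ReducedReflexFieldEq` of `Incoherent.lean`).
* `CMTypeChoice.conjAt`, `reducedSig_conjAt`: the conjugate datum (choice `τ̄₁'` above the
  `(n,1)`-place) has reduced signature the indicator of `τ̄₁'` — the K7 "conjugate canonical
  model" bookkeeping ([Liu21] Prop. C.5: both are fibres of one `E`-scheme).
-/

namespace Summit.Ventures.HodgeRepro2.ShimuraData

open NumberField

section ReflexPos

variable (K : Type*) [Field K] [NumberField K] [IsCMField K]

/-- The positive-definite normalisation of the Picard signature: `(n,1)` at the place of `τ₁`
and `(n+1,0)` at every other infinite place ([Liu21] Remark C.2: "signature `(n − 1, 1)` at `τ`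
and `(n, 0)` at other places"). -/
def IsPicardSignaturePos {n : ℕ} (τ₁ : K →+* ℂ) (H : Matrix (Fin (n + 1)) (Fin (n + 1)) K) :
    Prop :=
  signatureAt K τ₁ H = (n, 1) ∧
    ∀ τ : K →+* ℂ, InfinitePlace.mk τ ≠ InfinitePlace.mk τ₁ → signatureAt K τ H = (n + 1, 0)

variable {K}

omit [NumberField K] [IsCMField K] in
/-- The positive normalisation implies the Picard signature condition of `Hypothesis.lean`. -/
theorem IsPicardSignaturePos.isPicardSignature {n : ℕ} {τ₁ : K →+* ℂ}
    {H : Matrix (Fin (n + 1)) (Fin (n + 1)) K} (hH : IsPicardSignaturePos K τ₁ H) :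
    IsPicardSignature K τ₁ H :=
  ⟨hH.1, fun τ hτ => Or.inl (hH.2 τ hτ)⟩

open scoped Classical in
/-- Under the positive normalisation the reduced signature `Σ q_τ τ⁻` ([Liu21] Def. C.1) is the
indicator of the single embedding `Φ(mk τ₁)` chosen above the `(n,1)`-place. -/
theorem reducedSig_eq_single {n : ℕ} {τ₁ : K →+* ℂ} {H : Matrix (Fin (n + 1)) (Fin (n + 1)) K}
    (hherm : IsHermitianForm K H) (hH : IsPicardSignaturePos K τ₁ H) (Φ : CMTypeChoice K)
    (τ : K →+* ℂ) :
    reducedSig K Φ H τ = if τ = Φ.emb (InfinitePlace.mk τ₁) then 1 else 0 := by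
  unfold reducedSig
  by_cases hτ : InfinitePlace.mk τ = InfinitePlace.mk τ₁
  · rw [hτ]
    by_cases h : Φ.emb (InfinitePlace.mk τ₁) = τ
    · rw [if_pos h, if_pos h.symm, signatureAt_eq_of_mk_eq K hherm hτ, hH.1]
    · rw [if_neg h, if_neg (Ne.symm h)]
  · have hne : τ ≠ Φ.emb (InfinitePlace.mk τ₁) := by
      intro h; apply hτ; rw [h, Φ.emb_mk]
    rw [if_neg hne, hH.2 τ hτ]
    split_ifs <;> rfl

/-- [Liu21] Remark C.2, first sentence, at the level of the reduced signature: it depends only on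
the embedding chosen by `Φ` above the `(n,1)`-place. -/
theorem reducedSig_eq_of_emb_eq {n : ℕ} {τ₁ : K →+* ℂ} {H : Matrix (Fin (n + 1)) (Fin (n + 1)) K}
    (hherm : IsHermitianForm K H) (hH : IsPicardSignaturePos K τ₁ H) (Φ Φ' : CMTypeChoice K)
    (hΦ : Φ.emb (InfinitePlace.mk τ₁) = Φ'.emb (InfinitePlace.mk τ₁)) :
    reducedSig K Φ H = reducedSig K Φ' H := by
  funext τ
  rw [reducedSig_eq_single hherm hH Φ τ, reducedSig_eq_single hherm hH Φ' τ, hΦ]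

/-- Hence the reduced reflex field depends only on `Φ(mk τ₁)`. -/
theorem reducedReflexField_eq_of_emb_eq {n : ℕ} {τ₁ : K →+* ℂ}
    {H : Matrix (Fin (n + 1)) (Fin (n + 1)) K} (hherm : IsHermitianForm K H)
    (hH : IsPicardSignaturePos K τ₁ H) (Φ Φ' : CMTypeChoice K)
    (hΦ : Φ.emb (InfinitePlace.mk τ₁) = Φ'.emb (InfinitePlace.mk τ₁)) :
    reducedReflexField K Φ H = reducedReflexField K Φ' H := by
  unfold reducedReflexField reducedStabilizer
  rw [reducedSig_eq_of_emb_eq hherm hH Φ Φ' hΦ]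

/-- The stabiliser of the reduced signature is the set of automorphisms of `ℂ` fixing the
distinguished embedding `τ₁' = Φ(mk τ₁)` pointwise. -/
theorem reducedStabilizer_eq {n : ℕ} {τ₁ : K →+* ℂ} {H : Matrix (Fin (n + 1)) (Fin (n + 1)) K}
    (hherm : IsHermitianForm K H) (hH : IsPicardSignaturePos K τ₁ H) (Φ : CMTypeChoice K) :
    reducedStabilizer K Φ H =
      {σ : ℂ ≃+* ℂ |
        (σ : ℂ →+* ℂ).comp (Φ.emb (InfinitePlace.mk τ₁)) = Φ.emb (InfinitePlace.mk τ₁)} := by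
  classical
  ext σ
  simp only [reducedStabilizer, Set.mem_setOf_eq]
  constructor
  · intro hσ
    have h := hσ (Φ.emb (InfinitePlace.mk τ₁))
    rw [reducedSig_eq_single hherm hH, reducedSig_eq_single hherm hH, if_pos rfl] at h
    by_contra hne
    rw [if_neg hne] at h
    exact zero_ne_one h
  · intro hσ τ
    rw [reducedSig_eq_single hherm hH, reducedSig_eq_single hherm hH]
    by_cases h : τ = Φ.emb (InfinitePlace.mk τ₁)
    · rw [if_pos h, if_pos (by rw [h, hσ])]
    · rw [if_neg h, if_neg]
      intro h'
      apply h
      have hinj : Function.Injective fun ψ : K →+* ℂ => (σ : ℂ →+* ℂ).comp ψ := by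
        intro ψ₁ ψ₂ hψ
        ext x
        have := congrArg (fun f : K →+* ℂ => f x) hψ
        simpa using σ.injective this
      exact hinj (h'.trans hσ.symm)

/-- `τ₁'(K) ⊆ E'_{V,Φ}`: the image of the distinguished embedding lies in the reduced reflex field
(the easy half of [Liu21] Remark C.2 "the reflex field of `h_{V,τ'}` is `τ'(E)`"). -/
theorem fieldRange_le_reducedReflexField {n : ℕ} {τ₁ : K →+* ℂ}
    {H : Matrix (Fin (n + 1)) (Fin (n + 1)) K} (hherm : IsHermitianForm K H)
    (hH : IsPicardSignaturePos K τ₁ H) (Φ : CMTypeChoice K) :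
    (Φ.emb (InfinitePlace.mk τ₁)).fieldRange ≤ reducedReflexField K Φ H := by
  unfold reducedReflexField
  rw [reducedStabilizer_eq hherm hH Φ]
  refine le_iInf fun σ => le_iInf fun hσ => ?_
  rintro x ⟨y, rfl⟩
  simp only [Set.mem_setOf_eq] at hσ
  show (σ : ℂ →+* ℂ) (Φ.emb (InfinitePlace.mk τ₁) y) = RingHom.id ℂ (Φ.emb (InfinitePlace.mk τ₁) y)
  rw [RingHom.id_apply, ← RingHom.comp_apply, hσ]

end ReflexPos

section ConjugateDatum

variable {K : Type*} [Field K] [NumberField K] [IsCMField K]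

open scoped Classical in
/-- The CM-type choice with the embedding above `w` replaced by its complex conjugate: the
conjugate Shimura datum of the identification subtlety (K7) — the choice `τ̄₁` instead of `τ₁`
above the `(n,1)`-place ([Liu21] Remark C.2: the datum depends only on that choice). -/
noncomputable def CMTypeChoice.conjAt (Φ : CMTypeChoice K) (w : InfinitePlace K) :
    CMTypeChoice K where
  emb := Function.update Φ.emb w (ComplexEmbedding.conjugate (Φ.emb w))
  emb_mk := by
    intro v
    by_cases h : v = w
    · subst h
      rw [Function.update_self, InfinitePlace.mk_conjugate_eq, Φ.emb_mk]
    · rw [Function.update_of_ne h, Φ.emb_mk]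

open scoped Classical in
/-- For the conjugate choice above the `(n,1)`-place the reduced signature is the indicator of the
conjugate embedding `τ̄₁' = conjugate (Φ(mk τ₁))`: the two conjugate data have reduced reflex
fields `τ₁'(K)` and `τ̄₁'(K)` (the same subfield of `ℂ`, `K` being CM), reached through the two
conjugate embeddings — the "conjugate canonical models" of the same `E`-scheme ([Liu21]
Proposition C.5). -/
theorem reducedSig_conjAt {n : ℕ} {τ₁ : K →+* ℂ} {H : Matrix (Fin (n + 1)) (Fin (n + 1)) K}
    (hherm : IsHermitianForm K H) (hH : IsPicardSignaturePos K τ₁ H) (Φ : CMTypeChoice K)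
    (τ : K →+* ℂ) :
    reducedSig K (Φ.conjAt (InfinitePlace.mk τ₁)) H τ =
      if τ = ComplexEmbedding.conjugate (Φ.emb (InfinitePlace.mk τ₁)) then 1 else 0 := by
  rw [reducedSig_eq_single hherm hH (Φ.conjAt (InfinitePlace.mk τ₁)) τ]
  simp only [CMTypeChoice.conjAt, Function.update_self]

end ConjugateDatum

end Summit.Ventures.HodgeRepro2.ShimuraData
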